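/-
Copyright (c) 2026 the pub-hodgecm-mathlib formalisation cell (harness21).  Seat hodgecm-mathlib-F0P3a-p01 (g30): heir LEAD F0P3a-plan (g19) T18-06 (R-16) ORDER «RC-1»
(declared reshape, class refuted-MISSTATED-by-census; director g36 s1825; dealer LH4-plan (g10) WORD #28∕#29; referee ref4 R4-91∕R4-92).  2026-09-03.
-/
import Summits.HodgeConjecture.HodgeConjecture.Theorems.F0P3cDyRamFourFrameHSideDefs    -- ★ DEFS LEAF №2c «Δ + H-SIDE» (8297081aa343bca6): `FourFrameTransferFactor`, `HSideAnchorRows` — UNCHANGED, re-bundled by import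
import Summits.HodgeConjecture.HodgeConjecture.Theorems.F0P3cDyRamFourFrameLawDefsR   -- DEFS LEAF №1-R (RC-1): the schedules `shiftT` (of record) ∕ `shiftR` (re-cut)
import HarnessLib

/-!
# F0 · P3c · line LH4 «(D-RAM) FOUR-FRAME» — DEFS LEAF №2c-R «Δ + H-SIDE RE-CUT» (RC-1): (D-CΔ) and (D-H) with the parity-datum shift as a SCHEDULE,
# the `Iff.rfl` custody ties to ★ №2c at the schedule of record, and the R-names `FourFrameTransferFactorR` ∕ `HSideAnchorRowsR` at the re-cut schedule

WHY: see №1-R `F0P3cDyRamFourFrameLawDefsR` (e2c: the κ-amplitude token of record `2B_i = n_i − d + 2 − 2t_E` fails at the first `d < t` cell; the re-cut `2(d − d mod 2)` fits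
54∕54 and equals the token of record on the maximal types `d ∈ {t, t+1}`).  ★ №2c carries the SAME parity datum VERBATIM — (D-CΔ) `FourFrameTransferFactor` :93 (the binder
`(B : ℤ) (_ : 2B = … − 2t_E)` of the four-frame data) and (D-H) `HSideAnchorRows` :153 (row (1)'s `∀ i B, 2B = … − 2t_E → …`) — so the two registered U2H stubs
`stub_U2H_transferFactor_typeOne : FourFrameTransferFactor depthOfRecord` and `stub_U2H_hSideAnchorRows_unit0 : HSideAnchorRows depthOfRecord tauOfRecord 0` are MIS-AIMED at CM
places with `d < t` (LEAD T18-06 (2)).  DESIGN (supersede BY NAME, ★ №2c untouched): §S the two bodies of ★ №2c VERBATIM except `2 * tE ↦ 2 * shift d tE` for a schedule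
`shift : ℕ → ℕ → ℤ` — `FourFrameTransferFactorS shift N₀`, `HSideAnchorRowsS shift N₀ τ t`; §T the CUSTODY TIES `FourFrameTransferFactorS shiftT N₀ ↔ FourFrameTransferFactor N₀` and
`HSideAnchorRowsS shiftT N₀ τ t ↔ HSideAnchorRows N₀ τ t` (`Iff.rfl`: at the schedule of record the S-defs ARE ★ №2c's); §R the R-names at the re-cut schedule `shiftR d t = d − d mod 2`:
`FourFrameTransferFactorR N₀`, `HSideAnchorRowsR N₀ τ t`.  (The place datum `(d, t_E)` is bound INSIDE these closed Props, so the maximal-type agreement is the body-level fact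
№1-R `shiftR_eq_shiftT_of_maximal`; as closed Props over ALL places the R- and record versions differ — the R-version is the one aimed right at `d < t`.)  DEF LANE: `def`s +
`Iff.rfl` ties only; no instance, no notation, no sorry; nothing asserted (every Prop here is STAGE-1 debt: a dictionary to be PROVED by tier-2 files, never a fact).  RISK LINE (LEAD T18-07 (1), verbatim): «t-free token fitted on ONE d < t cell (e2c); d = 2∕4 at t = 6 (e3a, req629) pending».
HONEST LABEL: HC_CM is proved only modulo the 7 printed citations (2 remaining: hLiu418 = stmt-HodgeConjecture-24832, h413 = stmt-HodgeConjecture-24833) until rung 0 closes.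

## References
* [Rogawski1990] J. D. Rogawski, *Automorphic Representations of Unitary Groups in Three Variables*, Ann. of Math. Stud. 123 (1990): §4.9 Prop. 4.9.1 (a) p. 55; §8.1–§8.2; §12.2.
* [LanglandsShelstad1987] R. P. Langlands, D. Shelstad, *On the definition of transfer factors*, Math. Ann. 278 (1987): §3.
* [Kottwitz1986] R. Kottwitz, *Stable trace formula: elliptic singular terms*, Math. Ann. 275 (1986): §3.
-/

noncomputable section

namespace Summit.HodgeConjecture.HodgeConjecture.Cruxes.H413.F0P3cDyRamFourFrameHSideDefsR

open MeasureTheory Measure NumberField IsDedekindDomain Topology Filter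
open Literature.NumberTheory.Automorphic Literature.NumberTheory.Automorphic.UnitaryGroup Literature.NumberTheory.Automorphic.IntegralReduction
open Literature.NumberTheory.Automorphic.UnitaryLatticeTree Literature.NumberTheory.Automorphic.HermitianLattice
open Literature.NumberTheory.Rogawski1990 Literature.NumberTheory.GaloisRepresentations
open Literature.MeasureTheory.Group (descConj)
open Literature.NumberTheory.Automorphic.UnitaryThreeFourFrame
open scoped Matrix MatrixGroups Classical ValuativeRel WithZero
open Summit.HodgeConjecture.HodgeConjecture.Cruxes.H413.F0P3cDyRamFourFrameHSideDefs
open Summit.HodgeConjecture.HodgeConjecture.Cruxes.H413.F0P3cDyRamFourFrameLawDefsR (shiftT shiftR)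

/-! ## §S  (D-CΔ) and (D-H) with the parity-datum shift as a schedule (★ №2c bodies VERBATIM except `2 * tE ↦ 2 * shift d tE`) -/

/-- **(D-CΔ)-S `FourFrameTransferFactorS shift N₀`** — ★ №2c `FourFrameTransferFactor N₀` (:66) with the parity datum `2B = n_i − d + 2 − 2·shift d t_E`.  STAGE-1 debt (a dictionary
to be proved), nothing asserted. -/
def FourFrameTransferFactorS (shift : ℕ → ℕ → ℤ) (N₀ : ℕ → ℕ) : Prop :=
    ∀ (L : Type) [Field L] [NumberField L] [IsCMField L]
      {v : HeightOneSpectrum (𝓞 ↥(maximalRealSubfield L))} (w : UnitaryGroup.PlacesOver L v)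
      (hw : IsCMField.complexConj L • w.1 = w.1) (_he : v.asIdeal.ramificationIdx' w.1.asIdeal ≠ 1)
      (_h2 : ¬ IsUnit (2 : 𝒪[w.1.adicCompletion L]))
      (ϖ : (w.1.adicCompletion L)) (_hϖ : Valued.v ϖ = WithZero.exp (-1 : ℤ)) (d tE : ℕ) (_hD : IsRamifiedQuadraticDatum (galAdicCompletionMap (L := L) (IsCMField.complexConj L) hw) ϖ d tE)
      (μ : HeckeCharacter L) (_hμu : μ.IsUnitary)
      (_hμω : ∀ x : ideleGroup ↥(maximalRealSubfield L), μ (AdeleRing.ideleBaseChange ↥(maximalRealSubfield L) L x) = quadraticHeckeCharCM L x)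
      [MeasurableSpace ((UnitaryGroup.cmDatum L 3 (Matrix.of fun i j : Fin 3 => if i.val + j.val + 1 = 3 then (1 : L) else 0)).Local v)] [BorelSpace ((UnitaryGroup.cmDatum L 3 (Matrix.of fun i j : Fin 3 => if i.val + j.val + 1 = 3 then (1 : L) else 0)).Local v)]
      [∀ γ : ((UnitaryGroup.cmDatum L 3 (Matrix.of fun i j : Fin 3 => if i.val + j.val + 1 = 3 then (1 : L) else 0)).Local v), MeasurableSpace (((UnitaryGroup.cmDatum L 3 (Matrix.of fun i j : Fin 3 => if i.val + j.val + 1 = 3 then (1 : L) else 0)).Local v) ⧸ Subgroup.centralizer ({γ} : Set ((UnitaryGroup.cmDatum L 3 (Matrix.of fun i j : Fin 3 => if i.val + j.val + 1 = 3 then (1 : L) else 0)).Local v)))]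
      [∀ γ : ((UnitaryGroup.cmDatum L 3 (Matrix.of fun i j : Fin 3 => if i.val + j.val + 1 = 3 then (1 : L) else 0)).Local v), BorelSpace (((UnitaryGroup.cmDatum L 3 (Matrix.of fun i j : Fin 3 => if i.val + j.val + 1 = 3 then (1 : L) else 0)).Local v) ⧸ Subgroup.centralizer ({γ} : Set ((UnitaryGroup.cmDatum L 3 (Matrix.of fun i j : Fin 3 => if i.val + j.val + 1 = 3 then (1 : L) else 0)).Local v)))]
      [MeasurableSpace ((UnitaryGroup.cmDatum L 2 (Matrix.of fun i j : Fin 2 => if i.val + j.val + 1 = 2 then (1 : L) else 0)).Local v × (UnitaryGroup.cmDatum L 1 (Matrix.of fun i j : Fin 1 => if i.val + j.val + 1 = 1 then (1 : L) else 0)).Local v)] [BorelSpace ((UnitaryGroup.cmDatum L 2 (Matrix.of fun i j : Fin 2 => if i.val + j.val + 1 = 2 then (1 : L) else 0)).Local v × (UnitaryGroup.cmDatum L 1 (Matrix.of fun i j : Fin 1 => if i.val + j.val + 1 = 1 then (1 : L) else 0)).Local v)]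
      [∀ a : ((UnitaryGroup.cmDatum L 2 (Matrix.of fun i j : Fin 2 => if i.val + j.val + 1 = 2 then (1 : L) else 0)).Local v × (UnitaryGroup.cmDatum L 1 (Matrix.of fun i j : Fin 1 => if i.val + j.val + 1 = 1 then (1 : L) else 0)).Local v), MeasurableSpace (((UnitaryGroup.cmDatum L 2 (Matrix.of fun i j : Fin 2 => if i.val + j.val + 1 = 2 then (1 : L) else 0)).Local v × (UnitaryGroup.cmDatum L 1 (Matrix.of fun i j : Fin 1 => if i.val + j.val + 1 = 1 then (1 : L) else 0)).Local v) ⧸ Subgroup.centralizer ({a} : Set ((UnitaryGroup.cmDatum L 2 (Matrix.of fun i j : Fin 2 => if i.val + j.val + 1 = 2 then (1 : L) else 0)).Local v × (UnitaryGroup.cmDatum L 1 (Matrix.of fun i j : Fin 1 => if i.val + j.val + 1 = 1 then (1 : L) else 0)).Local v)))]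
      [∀ a : ((UnitaryGroup.cmDatum L 2 (Matrix.of fun i j : Fin 2 => if i.val + j.val + 1 = 2 then (1 : L) else 0)).Local v × (UnitaryGroup.cmDatum L 1 (Matrix.of fun i j : Fin 1 => if i.val + j.val + 1 = 1 then (1 : L) else 0)).Local v), BorelSpace (((UnitaryGroup.cmDatum L 2 (Matrix.of fun i j : Fin 2 => if i.val + j.val + 1 = 2 then (1 : L) else 0)).Local v × (UnitaryGroup.cmDatum L 1 (Matrix.of fun i j : Fin 1 => if i.val + j.val + 1 = 1 then (1 : L) else 0)).Local v) ⧸ Subgroup.centralizer ({a} : Set ((UnitaryGroup.cmDatum L 2 (Matrix.of fun i j : Fin 2 => if i.val + j.val + 1 = 2 then (1 : L) else 0)).Local v × (UnitaryGroup.cmDatum L 1 (Matrix.of fun i j : Fin 1 => if i.val + j.val + 1 = 1 then (1 : L) else 0)).Local v)))],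
      ∃ V ∈ 𝓝 (1 : ((UnitaryGroup.cmDatum L 2 (Matrix.of fun i j : Fin 2 => if i.val + j.val + 1 = 2 then (1 : L) else 0)).Local v × (UnitaryGroup.cmDatum L 1 (Matrix.of fun i j : Fin 1 => if i.val + j.val + 1 = 1 then (1 : L) else 0)).Local v)), ∀ γH ∈ V, IsLocalGRegular L v γH →
        (∃ x : (w.1.adicCompletion L), (((((γH).1.val : GL (Fin 2) (UnitaryGroup.LocalRing L v)).val.map (Pi.evalRingHom (fun w' : UnitaryGroup.PlacesOver L v => w'.1.adicCompletion L) w))).charpoly).IsRoot x) →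
        ¬ (∃ (y : ((UnitaryGroup.cmDatum L 2 (Matrix.of fun i j : Fin 2 => if i.val + j.val + 1 = 2 then (1 : L) else 0)).Local v × (UnitaryGroup.cmDatum L 1 (Matrix.of fun i j : Fin 1 => if i.val + j.val + 1 = 1 then (1 : L) else 0)).Local v)) (d' : Fin 2 → (UnitaryGroup.LocalRing L v)ˣ),
            glDiagonal 2 (UnitaryGroup.LocalRing L v) d' = ((y * γH * y⁻¹).1.val : GL (Fin 2) (UnitaryGroup.LocalRing L v))) →
        ∃ (f : Fin 4 → Fin 3 → (Fin 3 → (w.1.adicCompletion L))) (_ : IsFourFrameFamily (galAdicCompletionMap (L := L) (IsCMField.complexConj L) hw) f)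
          (a b z : (w.1.adicCompletion L)) (_ : a * (galAdicCompletionMap (L := L) (IsCMField.complexConj L) hw) a = 1) (_ : b * (galAdicCompletionMap (L := L) (IsCMField.complexConj L) hw) b = 1) (_ : z * (galAdicCompletionMap (L := L) (IsCMField.complexConj L) hw) z = 1)
          (_ : z = finGammaTwo L v γH w) (_ : ((((γH).1.val : GL (Fin 2) (UnitaryGroup.LocalRing L v)).val.map (Pi.evalRingHom (fun w' : UnitaryGroup.PlacesOver L v => w'.1.adicCompletion L) w))).charpoly.IsRoot (z * (a * a))) (_ : ((((γH).1.val : GL (Fin 2) (UnitaryGroup.LocalRing L v)).val.map (Pi.evalRingHom (fun w' : UnitaryGroup.PlacesOver L v => w'.1.adicCompletion L) w))).charpoly.IsRoot (z * (b * b)))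
          (_ : Valued.v (a - 1) < Valued.v (2 : (w.1.adicCompletion L))) (_ : Valued.v (b - 1) < Valued.v (2 : (w.1.adicCompletion L)))
          (n₁ n₂ n₃ : ℕ) (_ : IsElementDatum (galAdicCompletionMap (L := L) (IsCMField.complexConj L) hw) ϖ (N₀ d) (a * a) (b * b) n₁ n₂ n₃)
          (k : ℕ) (_ : 2 * k + d = n₁ + n₂ + n₃ + 2)
          (Γ : Fin 4 → GL (Fin 3) (w.1.adicCompletion L)) (_ : ∀ b', (Γ b' : Matrix (Fin 3) (Fin 3) (w.1.adicCompletion L)) = frameElt (galAdicCompletionMap (L := L) (IsCMField.complexConj L) hw) f b' (a * a) (b * b))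
          (tb : Fin 4 → ((UnitaryGroup.cmDatum L 3 (Matrix.of fun i j : Fin 3 => if i.val + j.val + 1 = 3 then (1 : L) else 0)).Local v)) (_ : ∀ b', ((((localNonsplitEquiv (IsCMField.complexConj L) (Matrix.of fun i j : Fin 3 => if i.val + j.val + 1 = 3 then (1 : L) else 0) (IsCMField.complexConj_ne_one L) w hw (tb b') :
              ↥(unitaryGroupOfForm (galAdicCompletionMap (L := L) (IsCMField.complexConj L) hw) (placeForm (Matrix.of fun i j : Fin 3 => if i.val + j.val + 1 = 3 then (1 : L) else 0) w.1))) : GL (Fin 3) (w.1.adicCompletion L)) : Matrix (Fin 3) (Fin 3) (w.1.adicCompletion L))) = z • (Γ b' : Matrix (Fin 3) (Fin 3) (w.1.adicCompletion L)))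
          (i : Fin 3) (B : ℤ) (_ : 2 * B = ((![n₁, n₂, n₃] : Fin 3 → ℕ) i : ℤ) - d + 2 - 2 * shift d tE),
          (∀ t : ((UnitaryGroup.cmDatum L 3 (Matrix.of fun i j : Fin 3 => if i.val + j.val + 1 = 3 then (1 : L) else 0)).Local v), IsLocalNormPair L (Matrix.of fun i j : Fin 3 => if i.val + j.val + 1 = 3 then (1 : L) else 0) v γH t ↔ ∃ b', ConjClasses.mk t = ConjClasses.mk (tb b')) ∧
          (∀ b' b'' : Fin 4, ConjClasses.mk (tb b') = ConjClasses.mk (tb b'') → b' = b'') ∧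
          (∀ b' : Fin 4, ((finExplicitCollection L (Matrix.of fun i j : Fin 3 => if i.val + j.val + 1 = 3 then (1 : L) else 0) μ (finExplicitDelta_conj_left_all L (Matrix.of fun i j : Fin 3 => if i.val + j.val + 1 = 3 then (1 : L) else 0) μ) (finExplicitDelta_conj_right_all L (Matrix.of fun i j : Fin 3 => if i.val + j.val + 1 = 3 then (1 : L) else 0) μ)) v).Δ γH (tb b') = ((finExplicitCollection L (Matrix.of fun i j : Fin 3 => if i.val + j.val + 1 = 3 then (1 : L) else 0) μ (finExplicitDelta_conj_left_all L (Matrix.of fun i j : Fin 3 => if i.val + j.val + 1 = 3 then (1 : L) else 0) μ) (finExplicitDelta_conj_right_all L (Matrix.of fun i j : Fin 3 => if i.val + j.val + 1 = 3 then (1 : L) else 0) μ)) v).Δ γH (tb 0) * (kappaChar i b' : ℂ))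

/-- **(D-H)-S `HSideAnchorRowsS shift N₀ τ t`** — ★ №2c `HSideAnchorRows N₀ τ t` (:111) with row (1)'s parity datum `2B = n_i − d + 2 − 2·shift d t_E`.  STAGE-1 debt, nothing asserted. -/
def HSideAnchorRowsS (shift : ℕ → ℕ → ℤ) (N₀ : ℕ → ℕ) (τ : ℕ → ℤ) (t : ℕ) : Prop :=
    ∀ (L : Type) [Field L] [NumberField L] [IsCMField L]
      {v : HeightOneSpectrum (𝓞 ↥(maximalRealSubfield L))} (w : UnitaryGroup.PlacesOver L v)
      (hw : IsCMField.complexConj L • w.1 = w.1) (_he : v.asIdeal.ramificationIdx' w.1.asIdeal ≠ 1)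
      (_h2 : ¬ IsUnit (2 : 𝒪[w.1.adicCompletion L]))
      (ϖ : (w.1.adicCompletion L)) (_hϖ : Valued.v ϖ = WithZero.exp (-1 : ℤ)) (d tE : ℕ) (_hD : IsRamifiedQuadraticDatum (galAdicCompletionMap (L := L) (IsCMField.complexConj L) hw) ϖ d tE)
      [Fintype (Valued.ResidueField (w.1.adicCompletion L))] (δ : (w.1.adicCompletion L)) (_hδ : (galAdicCompletionMap (L := L) (IsCMField.complexConj L) hw) δ = -δ) (_hδ0 : δ ≠ 0)
      (μ : HeckeCharacter L) (_hμu : μ.IsUnitary)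
      (_hμω : ∀ x : ideleGroup ↥(maximalRealSubfield L), μ (AdeleRing.ideleBaseChange ↥(maximalRealSubfield L) L x) = quadraticHeckeCharCM L x)
      [MeasurableSpace ((UnitaryGroup.cmDatum L 3 (Matrix.of fun i j : Fin 3 => if i.val + j.val + 1 = 3 then (1 : L) else 0)).Local v)] [BorelSpace ((UnitaryGroup.cmDatum L 3 (Matrix.of fun i j : Fin 3 => if i.val + j.val + 1 = 3 then (1 : L) else 0)).Local v)]
      [∀ γ : ((UnitaryGroup.cmDatum L 3 (Matrix.of fun i j : Fin 3 => if i.val + j.val + 1 = 3 then (1 : L) else 0)).Local v), MeasurableSpace (((UnitaryGroup.cmDatum L 3 (Matrix.of fun i j : Fin 3 => if i.val + j.val + 1 = 3 then (1 : L) else 0)).Local v) ⧸ Subgroup.centralizer ({γ} : Set ((UnitaryGroup.cmDatum L 3 (Matrix.of fun i j : Fin 3 => if i.val + j.val + 1 = 3 then (1 : L) else 0)).Local v)))]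
      [∀ γ : ((UnitaryGroup.cmDatum L 3 (Matrix.of fun i j : Fin 3 => if i.val + j.val + 1 = 3 then (1 : L) else 0)).Local v), BorelSpace (((UnitaryGroup.cmDatum L 3 (Matrix.of fun i j : Fin 3 => if i.val + j.val + 1 = 3 then (1 : L) else 0)).Local v) ⧸ Subgroup.centralizer ({γ} : Set ((UnitaryGroup.cmDatum L 3 (Matrix.of fun i j : Fin 3 => if i.val + j.val + 1 = 3 then (1 : L) else 0)).Local v)))]
      [MeasurableSpace ((UnitaryGroup.cmDatum L 2 (Matrix.of fun i j : Fin 2 => if i.val + j.val + 1 = 2 then (1 : L) else 0)).Local v × (UnitaryGroup.cmDatum L 1 (Matrix.of fun i j : Fin 1 => if i.val + j.val + 1 = 1 then (1 : L) else 0)).Local v)] [BorelSpace ((UnitaryGroup.cmDatum L 2 (Matrix.of fun i j : Fin 2 => if i.val + j.val + 1 = 2 then (1 : L) else 0)).Local v × (UnitaryGroup.cmDatum L 1 (Matrix.of fun i j : Fin 1 => if i.val + j.val + 1 = 1 then (1 : L) else 0)).Local v)]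
      [∀ a : ((UnitaryGroup.cmDatum L 2 (Matrix.of fun i j : Fin 2 => if i.val + j.val + 1 = 2 then (1 : L) else 0)).Local v × (UnitaryGroup.cmDatum L 1 (Matrix.of fun i j : Fin 1 => if i.val + j.val + 1 = 1 then (1 : L) else 0)).Local v), MeasurableSpace (((UnitaryGroup.cmDatum L 2 (Matrix.of fun i j : Fin 2 => if i.val + j.val + 1 = 2 then (1 : L) else 0)).Local v × (UnitaryGroup.cmDatum L 1 (Matrix.of fun i j : Fin 1 => if i.val + j.val + 1 = 1 then (1 : L) else 0)).Local v) ⧸ Subgroup.centralizer ({a} : Set ((UnitaryGroup.cmDatum L 2 (Matrix.of fun i j : Fin 2 => if i.val + j.val + 1 = 2 then (1 : L) else 0)).Local v × (UnitaryGroup.cmDatum L 1 (Matrix.of fun i j : Fin 1 => if i.val + j.val + 1 = 1 then (1 : L) else 0)).Local v)))]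
      [∀ a : ((UnitaryGroup.cmDatum L 2 (Matrix.of fun i j : Fin 2 => if i.val + j.val + 1 = 2 then (1 : L) else 0)).Local v × (UnitaryGroup.cmDatum L 1 (Matrix.of fun i j : Fin 1 => if i.val + j.val + 1 = 1 then (1 : L) else 0)).Local v), BorelSpace (((UnitaryGroup.cmDatum L 2 (Matrix.of fun i j : Fin 2 => if i.val + j.val + 1 = 2 then (1 : L) else 0)).Local v × (UnitaryGroup.cmDatum L 1 (Matrix.of fun i j : Fin 1 => if i.val + j.val + 1 = 1 then (1 : L) else 0)).Local v) ⧸ Subgroup.centralizer ({a} : Set ((UnitaryGroup.cmDatum L 2 (Matrix.of fun i j : Fin 2 => if i.val + j.val + 1 = 2 then (1 : L) else 0)).Local v × (UnitaryGroup.cmDatum L 1 (Matrix.of fun i j : Fin 1 => if i.val + j.val + 1 = 1 then (1 : L) else 0)).Local v)))]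
      (νH : Measure ((UnitaryGroup.cmDatum L 2 (Matrix.of fun i j : Fin 2 => if i.val + j.val + 1 = 2 then (1 : L) else 0)).Local v × (UnitaryGroup.cmDatum L 1 (Matrix.of fun i j : Fin 1 => if i.val + j.val + 1 = 1 then (1 : L) else 0)).Local v)) [νH.IsHaarMeasure] [νH.IsMulRightInvariant]
      (νG₃ : Measure ((UnitaryGroup.cmDatum L 3 (Matrix.of fun i j : Fin 3 => if i.val + j.val + 1 = 3 then (1 : L) else 0)).Local v)) [νG₃.IsHaarMeasure] [νG₃.IsMulRightInvariant]
      (mH : OrbitalMeasureFamily ((UnitaryGroup.cmDatum L 2 (Matrix.of fun i j : Fin 2 => if i.val + j.val + 1 = 2 then (1 : L) else 0)).Local v × (UnitaryGroup.cmDatum L 1 (Matrix.of fun i j : Fin 1 => if i.val + j.val + 1 = 1 then (1 : L) else 0)).Local v)) (mG₃ : OrbitalMeasureFamily ((UnitaryGroup.cmDatum L 3 (Matrix.of fun i j : Fin 3 => if i.val + j.val + 1 = 3 then (1 : L) else 0)).Local v))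
      (_hmH : mH.IsCanonical (IsLocalGRegular L v) νH) (_hmG : mG₃.IsCanonical (fun γ => IsRegularElt (γ.val : GL (Fin 3) (UnitaryGroup.LocalRing L v))) νG₃)
      (N : Submodule (Valued.integer (w.1.adicCompletion L)) (Fin 3 → (w.1.adicCompletion L))) (_hN : IsVertexLattice (galAdicCompletionMap (L := L) (IsCMField.complexConj L) hw) ϖ ((StdForm.antidiagonal 3).over (w.1.adicCompletion L)) t N)
      (Kt : Subgroup ((UnitaryGroup.cmDatum L 3 (Matrix.of fun i j : Fin 3 => if i.val + j.val + 1 = 3 then (1 : L) else 0)).Local v)) (_hKt : ∀ u : ((UnitaryGroup.cmDatum L 3 (Matrix.of fun i j : Fin 3 => if i.val + j.val + 1 = 3 then (1 : L) else 0)).Local v), u ∈ Kt ↔ mapGL ((localNonsplitEquiv (IsCMField.complexConj L) (Matrix.of fun i j : Fin 3 => if i.val + j.val + 1 = 3 then (1 : L) else 0) (IsCMField.complexConj_ne_one L) w hw u :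
              ↥(unitaryGroupOfForm (galAdicCompletionMap (L := L) (IsCMField.complexConj L) hw) (placeForm (Matrix.of fun i j : Fin 3 => if i.val + j.val + 1 = 3 then (1 : L) else 0) w.1))) : GL (Fin 3) (w.1.adicCompletion L)) N = N)
      (C : ℂ),
      -- v1.4 (ref4 R4-77 (J-3)): `C` TIED to the census — it must be the (D-G) dictionary constant of THIS anchor, not an arbitrary scalar
      (∀ (f : Fin 4 → Fin 3 → (Fin 3 → (w.1.adicCompletion L))), IsFourFrameFamily (galAdicCompletionMap (L := L) (IsCMField.complexConj L) hw) f →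
        ∀ (α β z : (w.1.adicCompletion L)), α * (galAdicCompletionMap (L := L) (IsCMField.complexConj L) hw) α = 1 → β * (galAdicCompletionMap (L := L) (IsCMField.complexConj L) hw) β = 1 → z * (galAdicCompletionMap (L := L) (IsCMField.complexConj L) hw) z = 1 → α ≠ β → α ≠ 1 → β ≠ 1 →
        ∀ (b : Fin 4) (Γ : GL (Fin 3) (w.1.adicCompletion L)), (Γ : Matrix (Fin 3) (Fin 3) (w.1.adicCompletion L)) = frameElt (galAdicCompletionMap (L := L) (IsCMField.complexConj L) hw) f b α β →
        ∀ (γ : ((UnitaryGroup.cmDatum L 3 (Matrix.of fun i j : Fin 3 => if i.val + j.val + 1 = 3 then (1 : L) else 0)).Local v)), ((((localNonsplitEquiv (IsCMField.complexConj L) (Matrix.of fun i j : Fin 3 => if i.val + j.val + 1 = 3 then (1 : L) else 0) (IsCMField.complexConj_ne_one L) w hw γ :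
              ↥(unitaryGroupOfForm (galAdicCompletionMap (L := L) (IsCMField.complexConj L) hw) (placeForm (Matrix.of fun i j : Fin 3 => if i.val + j.val + 1 = 3 then (1 : L) else 0) w.1))) : GL (Fin 3) (w.1.adicCompletion L)) : Matrix (Fin 3) (Fin 3) (w.1.adicCompletion L))) = z • (Γ : Matrix (Fin 3) (Fin 3) (w.1.adicCompletion L)) →
          classOrbitalIntegral mG₃ (Set.indicator (Kt : Set ((UnitaryGroup.cmDatum L 3 (Matrix.of fun i j : Fin 3 => if i.val + j.val + 1 = 3 then (1 : L) else 0)).Local v)) (fun _ => (1 : ℂ))) (ConjClasses.mk γ) = C * (fixedVertexCount (galAdicCompletionMap (L := L) (IsCMField.complexConj L) hw) ϖ t Γ : ℂ)) →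
      ∃ (r : ℕ) (ψ : Fin r → ((UnitaryGroup.cmDatum L 2 (Matrix.of fun i j : Fin 2 => if i.val + j.val + 1 = 2 then (1 : L) else 0)).Local v × (UnitaryGroup.cmDatum L 1 (Matrix.of fun i j : Fin 1 => if i.val + j.val + 1 = 1 then (1 : L) else 0)).Local v) → ℂ) (_ : ∀ s, IsLocSmooth (ψ s)) (coef : Fin r → ℂ),
        -- ROW (1), law-shaped: the H-side realises the sheet's signed κ-amplitude times the base transfer factor
        (∃ V ∈ 𝓝 (1 : ((UnitaryGroup.cmDatum L 2 (Matrix.of fun i j : Fin 2 => if i.val + j.val + 1 = 2 then (1 : L) else 0)).Local v × (UnitaryGroup.cmDatum L 1 (Matrix.of fun i j : Fin 1 => if i.val + j.val + 1 = 1 then (1 : L) else 0)).Local v)), ∀ γH ∈ V, IsLocalGRegular L v γH →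
          ∀ (f : Fin 4 → Fin 3 → (Fin 3 → (w.1.adicCompletion L))) (_hf : IsFourFrameFamily (galAdicCompletionMap (L := L) (IsCMField.complexConj L) hw) f)
        (a b z : (w.1.adicCompletion L)) (_ha : a * (galAdicCompletionMap (L := L) (IsCMField.complexConj L) hw) a = 1) (_hb : b * (galAdicCompletionMap (L := L) (IsCMField.complexConj L) hw) b = 1) (_hz : z * (galAdicCompletionMap (L := L) (IsCMField.complexConj L) hw) z = 1)
        (_hzγ : z = finGammaTwo L v γH w) (_hra : ((((γH).1.val : GL (Fin 2) (UnitaryGroup.LocalRing L v)).val.map (Pi.evalRingHom (fun w' : UnitaryGroup.PlacesOver L v => w'.1.adicCompletion L) w))).charpoly.IsRoot (z * (a * a))) (_hrb : ((((γH).1.val : GL (Fin 2) (UnitaryGroup.LocalRing L v)).val.map (Pi.evalRingHom (fun w' : UnitaryGroup.PlacesOver L v => w'.1.adicCompletion L) w))).charpoly.IsRoot (z * (b * b)))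
        (_ha1 : Valued.v (a - 1) < Valued.v (2 : (w.1.adicCompletion L))) (_hb1 : Valued.v (b - 1) < Valued.v (2 : (w.1.adicCompletion L)))
        (n₁ n₂ n₃ : ℕ) (_hE : IsElementDatum (galAdicCompletionMap (L := L) (IsCMField.complexConj L) hw) ϖ (N₀ d) (a * a) (b * b) n₁ n₂ n₃)
        (k : ℕ) (_hk : 2 * k + d = n₁ + n₂ + n₃ + 2)
        (Γ : Fin 4 → GL (Fin 3) (w.1.adicCompletion L)) (_hΓ : ∀ b', (Γ b' : Matrix (Fin 3) (Fin 3) (w.1.adicCompletion L)) = frameElt (galAdicCompletionMap (L := L) (IsCMField.complexConj L) hw) f b' (a * a) (b * b))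
        (tb : Fin 4 → ((UnitaryGroup.cmDatum L 3 (Matrix.of fun i j : Fin 3 => if i.val + j.val + 1 = 3 then (1 : L) else 0)).Local v)) (_htb : ∀ b', ((((localNonsplitEquiv (IsCMField.complexConj L) (Matrix.of fun i j : Fin 3 => if i.val + j.val + 1 = 3 then (1 : L) else 0) (IsCMField.complexConj_ne_one L) w hw (tb b') :
              ↥(unitaryGroupOfForm (galAdicCompletionMap (L := L) (IsCMField.complexConj L) hw) (placeForm (Matrix.of fun i j : Fin 3 => if i.val + j.val + 1 = 3 then (1 : L) else 0) w.1))) : GL (Fin 3) (w.1.adicCompletion L)) : Matrix (Fin 3) (Fin 3) (w.1.adicCompletion L))) = z • (Γ b' : Matrix (Fin 3) (Fin 3) (w.1.adicCompletion L)))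
            (i : Fin 3) (B : ℤ), 2 * B = ((![n₁, n₂, n₃] : Fin 3 → ℕ) i : ℤ) - d + 2 - 2 * shift d tE →
            (∀ t' : ((UnitaryGroup.cmDatum L 3 (Matrix.of fun i j : Fin 3 => if i.val + j.val + 1 = 3 then (1 : L) else 0)).Local v), IsLocalNormPair L (Matrix.of fun i j : Fin 3 => if i.val + j.val + 1 = 3 then (1 : L) else 0) v γH t' ↔ ∃ b', ConjClasses.mk t' = ConjClasses.mk (tb b')) →
            (∀ b' : Fin 4, ((finExplicitCollection L (Matrix.of fun i j : Fin 3 => if i.val + j.val + 1 = 3 then (1 : L) else 0) μ (finExplicitDelta_conj_left_all L (Matrix.of fun i j : Fin 3 => if i.val + j.val + 1 = 3 then (1 : L) else 0) μ) (finExplicitDelta_conj_right_all L (Matrix.of fun i j : Fin 3 => if i.val + j.val + 1 = 3 then (1 : L) else 0) μ)) v).Δ γH (tb b') = ((finExplicitCollection L (Matrix.of fun i j : Fin 3 => if i.val + j.val + 1 = 3 then (1 : L) else 0) μ (finExplicitDelta_conj_left_all L (Matrix.of fun i j : Fin 3 => if i.val + j.val + 1 = 3 then (1 : L) else 0) μ)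 (finExplicitDelta_conj_right_all L (Matrix.of fun i j : Fin 3 => if i.val + j.val + 1 = 3 then (1 : L) else 0) μ)) v).Δ γH (tb 0) * (kappaChar i b' : ℂ)) →
            ∑ s, coef s * stableOrbitalIntegralRel (IsLocalStablyConjH L v) mH (ψ s) γH =
              ((finExplicitCollection L (Matrix.of fun i j : Fin 3 => if i.val + j.val + 1 = 3 then (1 : L) else 0) μ (finExplicitDelta_conj_left_all L (Matrix.of fun i j : Fin 3 => if i.val + j.val + 1 = 3 then (1 : L) else 0) μ) (finExplicitDelta_conj_right_all L (Matrix.of fun i j : Fin 3 => if i.val + j.val + 1 = 3 then (1 : L) else 0) μ)) v).Δ γH (tb 0) * C *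
                (((baseSign (galAdicCompletionMap (L := L) (IsCMField.complexConj L) hw) i * normSign (galAdicCompletionMap (L := L) (IsCMField.complexConj L) hw) (fPartProd δ ![a, b, 1] i) : ℤ) : ℂ) *
                  ((ampl (Fintype.card (Valued.ResidueField (w.1.adicCompletion L))) k (if t = 0 then B else B + τ d) : ℚ) : ℂ))) ∧
        -- ROW (2), type (2), transfer-shaped (law debt)
        (∃ V ∈ 𝓝 (1 : ((UnitaryGroup.cmDatum L 2 (Matrix.of fun i j : Fin 2 => if i.val + j.val + 1 = 2 then (1 : L) else 0)).Local v × (UnitaryGroup.cmDatum L 1 (Matrix.of fun i j : Fin 1 => if i.val + j.val + 1 = 1 then (1 : L) else 0)).Local v)), ∀ γH ∈ V, IsLocalGRegular L v γH →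
        ¬ (∃ x : (w.1.adicCompletion L), (((((γH).1.val : GL (Fin 2) (UnitaryGroup.LocalRing L v)).val.map (Pi.evalRingHom (fun w' : UnitaryGroup.PlacesOver L v => w'.1.adicCompletion L) w))).charpoly).IsRoot x) →
        ∑ᶠ c : ConjClasses ((UnitaryGroup.cmDatum L 3 (Matrix.of fun i j : Fin 3 => if i.val + j.val + 1 = 3 then (1 : L) else 0)).Local v), ((finExplicitCollection L (Matrix.of fun i j : Fin 3 => if i.val + j.val + 1 = 3 then (1 : L) else 0) μ (finExplicitDelta_conj_left_all L (Matrix.of fun i j : Fin 3 => if i.val + j.val + 1 = 3 then (1 : L) else 0) μ) (finExplicitDelta_conj_right_all L (Matrix.of fun i j : Fin 3 => if i.val + j.val + 1 = 3 then (1 : L) else 0) μ)) v).Δ γH (Quotient.out c) * classOrbitalIntegral mG₃ (Set.indicator (Kt : Set ((UnitaryGroup.cmDatum L 3 (Matrix.of fun i j : Fin 3 => if i.val + j.val + 1 = 3 then (1 : L) else 0)).Local v)) (fun _ => (1 : ℂ))) c =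
          ∑ s, coef s * stableOrbitalIntegralRel (IsLocalStablyConjH L v) mH (ψ s) γH) ∧
        -- ROW (3), Levi, transfer-shaped (law debt)
        (∃ V ∈ 𝓝 (1 : ((UnitaryGroup.cmDatum L 2 (Matrix.of fun i j : Fin 2 => if i.val + j.val + 1 = 2 then (1 : L) else 0)).Local v × (UnitaryGroup.cmDatum L 1 (Matrix.of fun i j : Fin 1 => if i.val + j.val + 1 = 1 then (1 : L) else 0)).Local v)), ∀ γH ∈ V, IsLocalGRegular L v γH →
        (∃ (y : ((UnitaryGroup.cmDatum L 2 (Matrix.of fun i j : Fin 2 => if i.val + j.val + 1 = 2 then (1 : L) else 0)).Local v × (UnitaryGroup.cmDatum L 1 (Matrix.of fun i j : Fin 1 => if i.val + j.val + 1 = 1 then (1 : L) else 0)).Local v)) (d' : Fin 2 → (UnitaryGroup.LocalRing L v)ˣ),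
            glDiagonal 2 (UnitaryGroup.LocalRing L v) d' = ((y * γH * y⁻¹).1.val : GL (Fin 2) (UnitaryGroup.LocalRing L v))) →
        ∑ᶠ c : ConjClasses ((UnitaryGroup.cmDatum L 3 (Matrix.of fun i j : Fin 3 => if i.val + j.val + 1 = 3 then (1 : L) else 0)).Local v), ((finExplicitCollection L (Matrix.of fun i j : Fin 3 => if i.val + j.val + 1 = 3 then (1 : L) else 0) μ (finExplicitDelta_conj_left_all L (Matrix.of fun i j : Fin 3 => if i.val + j.val + 1 = 3 then (1 : L) else 0) μ) (finExplicitDelta_conj_right_all L (Matrix.of fun i j : Fin 3 => if i.val + j.val + 1 = 3 then (1 : L) else 0) μ)) v).Δ γH (Quotient.out c) * classOrbitalIntegral mG₃ (Set.indicator (Kt : Set ((UnitaryGroup.cmDatum L 3 (Matrix.of fun i j : Fin 3 => if i.val + j.val + 1 = 3 then (1 : L) else 0)).Local v)) (fun _ => (1 : ℂ))) c =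
          ∑ s, coef s * stableOrbitalIntegralRel (IsLocalStablyConjH L v) mH (ψ s) γH)

/-! ## §T  Custody ties: at the schedule of record the S-defs ARE ★ №2c's (`Iff.rfl`) -/

/-- T1 · `FourFrameTransferFactorS shiftT N₀ ↔ FourFrameTransferFactor N₀` — `Iff.rfl`. -/
theorem fourFrameTransferFactorS_shiftT_iff (N₀ : ℕ → ℕ) : FourFrameTransferFactorS shiftT N₀ ↔ FourFrameTransferFactor N₀ :=
  Iff.rfl

/-- T2 · `HSideAnchorRowsS shiftT N₀ τ t ↔ HSideAnchorRows N₀ τ t` — `Iff.rfl`. -/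
theorem hSideAnchorRowsS_shiftT_iff (N₀ : ℕ → ℕ) (τ : ℕ → ℤ) (t : ℕ) : HSideAnchorRowsS shiftT N₀ τ t ↔ HSideAnchorRows N₀ τ t :=
  Iff.rfl

/-! ## §R  The R-names at the re-cut schedule -/

/-- **(D-CΔ)-R `FourFrameTransferFactorR N₀ := FourFrameTransferFactorS shiftR N₀`** — the RC-1 re-aim of U2H stub #5's statement.  STAGE-1 debt, nothing asserted. -/
def FourFrameTransferFactorR (N₀ : ℕ → ℕ) : Prop := FourFrameTransferFactorS shiftR N₀

/-- **(D-H)-R `HSideAnchorRowsR N₀ τ t := HSideAnchorRowsS shiftR N₀ τ t`** — the RC-1 re-aim of U2H stub #3's statement.  STAGE-1 debt, nothing asserted. -/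
def HSideAnchorRowsR (N₀ : ℕ → ℕ) (τ : ℕ → ℤ) (t : ℕ) : Prop := HSideAnchorRowsS shiftR N₀ τ t

/-- R · unfolding ties (`Iff.rfl`). -/
theorem fourFrameTransferFactorR_iff (N₀ : ℕ → ℕ) : FourFrameTransferFactorR N₀ ↔ FourFrameTransferFactorS shiftR N₀ := Iff.rfl

/-- R · unfolding tie (`Iff.rfl`). -/
theorem hSideAnchorRowsR_iff (N₀ : ℕ → ℕ) (τ : ℕ → ℤ) (t : ℕ) : HSideAnchorRowsR N₀ τ t ↔ HSideAnchorRowsS shiftR N₀ τ t := Iff.rfl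

end Summit.HodgeConjecture.HodgeConjecture.Cruxes.H413.F0P3cDyRamFourFrameHSideDefsR

end
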